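import Summits.ResolutionOfSingularities.ResolutionOfSingularities.Theses.DefectlessFrames
import Summits.ResolutionOfSingularities.ResolutionOfSingularities.Theorems.DefectlessFramesDefectlessFramesRefutation

/-!
# Negative lemma for crux `ZariskiCMEngine` (stmt-ResolutionOfSingularities-17922): the typed
# first lemma `AttainedDistanceOfDefectless` of crux idea `henselized-frame-valuation-basis` is FALSE

Candidate-stub kill (cdisprove cycle 1, §4 of `Cruxes/ZariskiCMEngine/Disproof.lean`). The idea
card `Cruxes/ZariskiCMEngine/Ideas/henselized-frame-valuation-basis.md` (crux-ideate r1 k2) proposes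
as the FIRST LEMMA of its line for this crux the statement reproduced verbatim below under the
negation: from the defectless clause of `DefectlessFramesR` (`[T : F] = e·f` for subfields
`F ≤ T` of a valued field `(Ω, V)`) it wants, for every `z ∈ T`, an `h ∈ F` with
`V.valuation (z - a) ≤ V.valuation (z - h)` for all `a ∈ F`. This transcribes Cutkosky–Mourtada's
ADDITIVE "`ν*(z − h) = max ν*(z − K)`" (arXiv:1711.02726, Thm 7.1) literally into Mathlib's
MULTIPLICATIVE order, in which a best approximant MINIMISES `V.valuation (z - h)`: as typed it
asks for a MAXIMUM of `{ |z − a| : a ∈ F }`, which never exists once `V` is non-trivial on `F`.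
Witness: `Ω = 𝔽₂(X)`, `V = 𝔽₂[X]_{(X)}`, `F = T = ⊤` (all hypotheses hold: `[T:F] = 1 = 1·1`),
`z = 0`; a maximiser `h` of `|a|` over `𝔽₂(X)` is beaten by `X⁻¹h` (or by `1` if `h = 0`).
Repaired statement C′ (recorded in the Disproof file as `AttainedDistanceOfDefectless'`): reverse
the inequality, `V.valuation (z - h) ≤ V.valuation (z - a)` — the valuation-basis
best-approximation lemma, plausible and untouched by this witness.
-/

set_option linter.dupNamespace false

namespace Summit.ResolutionOfSingularities.ResolutionOfSingularities.Theorems.ZariskiCMEngine.Negative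

open Summit.ResolutionOfSingularities.ResolutionOfSingularities.Theorems.DefectlessFramesRefutation

/-- `X⁻¹ ∉ 𝔽₂[X]_{(X)}`: the `X`-adic valuation is non-trivial on `𝔽₂(X)`. [folklore] -/
theorem inv_X_not_mem_OX : (RatFunc.X : KW)⁻¹ ∉ OX := by
  rw [Valuation.mem_valuationSubring_iff, map_inv₀]
  change ¬ (vX RatFunc.X)⁻¹ ≤ 1
  rw [Polynomial.valuation_X_eq_neg_one, ← WithZero.exp_neg, ← WithZero.exp_zero,
    WithZero.exp_le_exp]
  decide

/-- **The first lemma `AttainedDistanceOfDefectless` of crux idea `henselized-frame-valuation-basis`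
is false as typed** (direction of `≤` inverted: it asks for a WORST approximant). The negated
statement is the card's text verbatim. Witness `Ω = 𝔽₂(X)`, `V = 𝔽₂[X]_{(X)}`, `F = T = ⊤`,
`z = 0`. [folklore] -/
theorem not_attainedDistanceOfDefectless :
    ¬ ∀ (Ω : Type) [Field Ω] (V : ValuationSubring Ω) (F T : Subfield Ω), F ≤ T →
      0 < Subfield.relfinrank F T →
      Subfield.relfinrank F T =
        (Literature.AlgebraicGeometry.Resolution.valueSubgroup F V).relIndex
          (Literature.AlgebraicGeometry.Resolution.valueSubgroup T V) *
        (Literature.AlgebraicGeometry.Resolution.residueSubfield F V).relfinrank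
          (Literature.AlgebraicGeometry.Resolution.residueSubfield T V) →
      ∀ z ∈ T, ∃ h ∈ F, ∀ a ∈ F, V.valuation (z - a) ≤ V.valuation (z - h) := by
  intro H
  obtain ⟨h, -, hh⟩ := H KW OX ⊤ ⊤ le_rfl (by rw [Subfield.relfinrank_self]; exact one_pos)
    (by rw [Subfield.relfinrank_self, Subgroup.relIndex_self, Subfield.relfinrank_self])
    0 (Subfield.mem_top _)
  by_cases h0 : h = 0
  · have h1 := hh 1 (Subfield.mem_top _)
    rw [h0, sub_zero, zero_sub, Valuation.map_neg, map_one, map_zero] at h1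
    exact absurd h1 (not_le.mpr zero_lt_one)
  · have hvh : OX.valuation h ≠ 0 := (map_ne_zero _).mpr h0
    have h1 := hh ((RatFunc.X : KW)⁻¹ * h) (Subfield.mem_top _)
    rw [zero_sub, zero_sub, Valuation.map_neg, Valuation.map_neg, map_mul] at h1
    have h2 : OX.valuation (RatFunc.X : KW)⁻¹ ≤ 1 :=
      calc OX.valuation (RatFunc.X : KW)⁻¹
          = OX.valuation (RatFunc.X : KW)⁻¹ * OX.valuation h * (OX.valuation h)⁻¹ := by
            rw [mul_inv_cancel_right₀ hvh]
        _ ≤ OX.valuation h * (OX.valuation h)⁻¹ := mul_le_mul_left h1 _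
        _ = 1 := mul_inv_cancel₀ hvh
    exact inv_X_not_mem_OX ((OX.valuation_le_one_iff _).mp h2)

/-- The REPAIRED direction is consistent on the slice used by the witness (`F = T`: `h = z`), so
the repair C′ is not hit by it. [folklore] -/
theorem attainedDistance_repaired_self (Ω : Type) [Field Ω] (V : ValuationSubring Ω)
    (F : Subfield Ω) : ∀ z ∈ F, ∃ h ∈ F, ∀ a ∈ F, V.valuation (z - h) ≤ V.valuation (z - a) :=
  fun z hz => ⟨z, hz, fun a _ => by rw [sub_self, map_zero]; exact zero_le⟩

end Summit.ResolutionOfSingularities.ResolutionOfSingularities.Theorems.ZariskiCMEngine.Negative
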